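/-
Copyright: pub-rosobs cell (Resolution Observatory), carver gen 43.  Companion file; statements OURS, in
the cell's polynomial weighted-centre model `W(f)`.  Instrument — NOT a resolution theorem.
-/
import Literature.AlgebraicGeometry.Resolution.WeightedCentreResidualLower
import HarnessLib

/-!
# The graph-type restriction step: `max W(X_a^q + h) = sort (q, max C_q(h))` when the maximum splits

[cite: AbramovichTemkinWlodarczyk2024, §5.1 (p. 1575) (maximal contact `H = V(x₁)`, the coefficient ideal
restricted to `H`, `inv = (a₁, inv of the restriction)`), Thm. 5.3.1 (2)–(3) (p. 1578) (`inv = max (b₁,…,b_k)`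
over admissible centres; independence of the choices), Lemma 5.2.6 (p. 1576), Lemma 5.2.10 (p. 1577)]
[cite: CossartJannsenSaito2020, Def. 1.26 (restriction to a coordinate subspace), Def. 8.2 (p. 118)].

`WeightedCentreResidualLower` typed the census's `q`-residual invariants `residualInvariants q a h` (engine 1,
FE35: the data `C_q(h)`) and LEMMA L, the lower bound `sort (q, b) ∈ W(X_a^q + h)` for every residual invariant
`b`.  This file types the two remaining UNCONDITIONAL lemmas of FE35 in the polynomial model:

* **the restriction step** (`IsCentreFor.graphRestrict`, every characteristic, every `F`): if a centre
  `(Ψ, w)` for `F` has a variable of GRAPH TYPE over `X_a`, `Ψ(X_j) = c·X_a + ψ` with `c ≠ 0` and `ψ` free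
  of `X_a`, then the restriction `F|_{z_j = 0} = (X_a ↦ −ψ/c)(F)` admits a centre living off `X_a` whose
  invariant is `exps w` with the `j`-th exponent deleted.  The restricted variables `(X_a ↦ −ψ/c)(Ψ X_i)`,
  `i ≠ j`, together with `X_a` are again a coordinate system because a surjective endomorphism of the
  Noetherian ring `k[X]` is an automorphism; no Weierstrass preparation is needed for graph-type variables;
* **LEMMA R** (`exps_update_mem_residualInvariants`, `q = p^n` in characteristic `p`): for `F = X_a^q + h`
  the restriction is `h − (ψ/c)^q`, so the deleted invariant is a `q`-residual invariant of `h`;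
* **LEMMA S** (`isMaxInv_residualInvariants_of_graph`): if `max W(X_a^q + h)` is attained by a centre with a
  graph-type variable over `X_a` of exponent `1/w_j ≤ q`, then `1/w_j = q`, the deleted invariant is
  `max residualInvariants q a h`, and `max W(X_a^q + h) = sort (q, max C_q(h))` — Lemma L gives `≥`, the
  insertion lemmas for the truncated-lex order (`§4`) turn a larger residual invariant or a smaller first
  exponent into a larger element of `W`.

What is NOT typed: that a maximal centre can always be chosen with such a graph-type variable (FE35 Lemmas
N/P, the census's normal form); the residual law is therefore certified only for maxima that split.
Worked instance (`§5`, characteristic `2`): the split maximum `(2, 4, 4)` of `x² + (y² + y³z)`, attained by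
`(x + y, y, z; 1/2, 1/4, 1/4)`, certifies `max C_2(y² + y³z) = (4, 4)` relative to `x`.
-/

noncomputable section

open MvPolynomial

namespace Literature.AlgebraicGeometry.Resolution.WeightedBlowup

variable {k : Type*} [Field k] {N : ℕ}

/-! ## §0 Plumbing -/

/-- An algebra endomorphism fixing every variable of `P` fixes `P` (plumbing). [folklore] -/
private theorem algHom_eq_self_of_forall_vars₁₄ {σ K : Type*} [CommSemiring K]
    (Φ : MvPolynomial σ K →ₐ[K] MvPolynomial σ K) {P : MvPolynomial σ K}
    (h : ∀ x ∈ P.vars, Φ (X x) = X x) : Φ P = P := by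
  change Φ.toRingHom P = RingHom.id _ P
  refine hom_congr_vars ?_ (fun x hx _ => ?_) rfl
  · ext c
    simp
  · simpa using h x hx

/-- An algebra endomorphism fixing the origin preserves constant coefficients (plumbing). [folklore] -/
private theorem constantCoeff_algHom_of_forall₁₄ {σ K : Type*} [CommSemiring K]
    (Φ : MvPolynomial σ K →ₐ[K] MvPolynomial σ K) (hΦ : ∀ x, constantCoeff (Φ (X x)) = 0)
    (P : MvPolynomial σ K) : constantCoeff (Φ P) = constantCoeff P := by
  induction P using MvPolynomial.induction_on with
  | C r => rw [algHom_C, algebraMap_eq]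
  | add p q hp hq => rw [map_add, map_add, map_add, hp, hq]
  | mul_X p x hp => rw [map_mul, map_mul, map_mul, hp, hΦ, constantCoeff_X]

/-- A surjective ring endomorphism of a Noetherian ring is injective: the kernels of its iterates
stabilise (plumbing). [folklore] -/
private theorem injective_of_surjective_ringHom₁₄ {R : Type*} [CommRing R] [IsNoetherianRing R]
    (f : R →+* R) (hf : Function.Surjective f) : Function.Injective f := by
  let K : ℕ →o Ideal R :=
    { toFun := fun n => RingHom.ker (f ^ n)
      monotone' := by
        intro m n hmn x hx
        rw [RingHom.mem_ker] at hx ⊢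
        obtain ⟨k, rfl⟩ := Nat.exists_eq_add_of_le hmn
        rw [RingHom.coe_pow] at hx ⊢
        rw [add_comm, Function.iterate_add_apply, hx, ← RingHom.coe_pow, map_zero] }
  obtain ⟨M, hM⟩ := (monotone_stabilizes_iff_noetherian.mpr (inferInstance : IsNoetherian R R)) K
  rw [injective_iff_map_eq_zero]
  intro x hx
  obtain ⟨y, rfl⟩ := (hf.iterate M) x
  have hy : y ∈ K (M + 1) := by
    show y ∈ RingHom.ker (f ^ (M + 1))
    rw [RingHom.mem_ker, RingHom.coe_pow, Function.iterate_succ_apply']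
    exact hx
  rw [← hM (M + 1) (Nat.le_succ M)] at hy
  change y ∈ RingHom.ker (f ^ M) at hy
  rw [RingHom.mem_ker, RingHom.coe_pow] at hy
  exact hy

/-! ## §1 Restriction to a graph `X_a = φ` -/

/-- **Restriction to the graph hypersurface `X_a = φ`**: the substitution `X_a ↦ φ`, every other variable
fixed (construction; for `φ` free of `X_a` it is the restriction `k[X] → k[X]/(X_a − φ) ≅ k[X_{≠ a}]`
followed by the inclusion — the polynomial model of restricting to a hypersurface of maximal contact given
as a graph). [cite: AbramovichTemkinWlodarczyk2024, §5.1 (p. 1575) (restriction to `H = V(x₁)`)]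
[cite: CossartJannsenSaito2020, Def. 1.26 (restriction to a subspace)] -/
def graphSubst (a : Fin N) (φ : MvPolynomial (Fin N) k) :
    MvPolynomial (Fin N) k →ₐ[k] MvPolynomial (Fin N) k :=
  aeval fun x => if x = a then φ else X x

/-- Value on the substituted variable (plumbing). [cite: CossartJannsenSaito2020, Def. 1.26] -/
@[simp] theorem graphSubst_X_self (a : Fin N) (φ : MvPolynomial (Fin N) k) : graphSubst a φ (X a) = φ := by
  rw [graphSubst, aeval_X, if_pos rfl]

/-- Value on the other variables (plumbing). [cite: CossartJannsenSaito2020, Def. 1.26] -/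
@[simp] theorem graphSubst_X_of_ne (a : Fin N) (φ : MvPolynomial (Fin N) k) {x : Fin N} (hx : x ≠ a) :
    graphSubst a φ (X x) = X x := by
  rw [graphSubst, aeval_X, if_neg hx]

/-- A polynomial free of `X_a` is its own restriction. (derived here) [cite: CossartJannsenSaito2020, Def. 1.26] -/
theorem graphSubst_eq_self_of_notMem (a : Fin N) (φ : MvPolynomial (Fin N) k) {P : MvPolynomial (Fin N) k}
    (hP : a ∉ P.vars) : graphSubst a φ P = P :=
  algHom_eq_self_of_forall_vars₁₄ _ fun x hx => graphSubst_X_of_ne a φ (x := x) fun h => hP (h ▸ hx)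

/-- Restriction to a graph through the origin preserves values at the origin. (derived here)
[cite: AbramovichTemkinWlodarczyk2024, Lemma 5.2.10 (p. 1577)] -/
theorem constantCoeff_graphSubst (a : Fin N) {φ : MvPolynomial (Fin N) k} (hφ : constantCoeff φ = 0)
    (P : MvPolynomial (Fin N) k) : constantCoeff (graphSubst a φ P) = constantCoeff P :=
  constantCoeff_algHom_of_forall₁₄ _ (fun x => by
    by_cases hx : x = a
    · rw [hx, graphSubst_X_self, hφ]
    · rw [graphSubst_X_of_ne a φ hx, constantCoeff_X]) P

/-- On `F = X_a^q + h` with `h` free of `X_a`: `(X_a ↦ φ)(F) = φ^q + h`. (derived here)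
[cite: AbramovichTemkinWlodarczyk2024, §5.1 (p. 1575)] -/
theorem graphSubst_X_pow_add (a : Fin N) (φ : MvPolynomial (Fin N) k) (q : ℕ) {h : MvPolynomial (Fin N) k}
    (hh : a ∉ h.vars) : graphSubst a φ (X a ^ q + h) = φ ^ q + h := by
  rw [map_add, map_pow, graphSubst_X_self, graphSubst_eq_self_of_notMem a φ hh]

/-- The graph-type variable dies under the restriction: `(X_a ↦ −ψ/c)(c·X_a + ψ) = 0`. (derived here)
[cite: AbramovichTemkinWlodarczyk2024, §5.1 (p. 1575)] -/
theorem graphSubst_graphSlot {a : Fin N} {c : k} {ψ : MvPolynomial (Fin N) k} (hc0 : c ≠ 0) (hψ : a ∉ ψ.vars) :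
    graphSubst a (-(C c⁻¹ * ψ)) (C c * X a + ψ) = 0 := by
  rw [map_add, map_mul, algHom_C, algebraMap_eq, graphSubst_X_self, graphSubst_eq_self_of_notMem a _ hψ,
    show C c * -(C c⁻¹ * ψ) + ψ = (1 - C c * C c⁻¹) * ψ by ring, ← C_mul, mul_inv_cancel₀ hc0, C_1,
    sub_self, zero_mul]

/-! ## §2 Restricting a centre along a graph-type centre variable -/

section Restrict

variable {F : MvPolynomial (Fin N) k} {Ψ : MvPolynomial (Fin N) k ≃ₐ[k] MvPolynomial (Fin N) k}
  {w : Fin N → ℚ} {a j : Fin N} {c : k} {ψ : MvPolynomial (Fin N) k}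

/-- **Restriction of a centre along a graph-type centre variable.** Let `(Ψ, w)` be a centre for `F` one of
whose variables is of graph type over `X_a`: `Ψ(X_j) = c·X_a + ψ`, `c ≠ 0`, `ψ` free of `X_a`. Then the
restriction `(X_a ↦ −ψ/c)(F)` of `F` to `{z_j = 0}` admits a centre `(Ψ', w')` living off `X_a`
(`Ψ'⁻¹ X_a = X_a`, `w'_a = 0`) whose invariant is `exps w` with the `j`-th exponent deleted:
`exps w' = exps (w with w_j := 0)` — the restricted variables `(X_a ↦ −ψ/c)(Ψ X_i)`, `i ≠ j`, and `X_a` form a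
coordinate system (a surjective endomorphism of the Noetherian ring `k[X]` is bijective), in which the
restriction reads `(Ψ⁻¹ F)|_{X_j = 0}`. (derived here)
[cite: AbramovichTemkinWlodarczyk2024, §5.1 (p. 1575) (restriction of the coefficient ideal to the maximal
contact hypersurface), Thm. 5.3.1 (3) (p. 1578) (independence of the choices)]
[cite: CossartJannsenSaito2020, Def. 1.26] -/
theorem IsCentreFor.graphRestrict (h : IsCentreFor F Ψ w) (hc0 : c ≠ 0) (hψ : a ∉ ψ.vars)
    (hj : Ψ (X j) = C c * X a + ψ) :
    ∃ (Ψ' : MvPolynomial (Fin N) k ≃ₐ[k] MvPolynomial (Fin N) k) (w' : Fin N → ℚ),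
      Ψ'.symm (X a) = X a ∧ w' a = 0 ∧ IsCentreFor (graphSubst a (-(C c⁻¹ * ψ)) F) Ψ' w' ∧
        exps w' = exps (Function.update w j 0) := by
  classical
  obtain ⟨hΨ0, hw0, hadm⟩ := h
  -- constant coefficients
  have hψ0 : constantCoeff ψ = 0 := by
    have h0 := hΨ0 j
    rwa [hj, map_add, map_mul, constantCoeff_C, constantCoeff_X, mul_zero, zero_add] at h0
  have hφ0 : constantCoeff (-(C c⁻¹ * ψ)) = 0 := by
    rw [map_neg, map_mul, constantCoeff_C, hψ0, mul_zero, neg_zero]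
  have hρj : graphSubst a (-(C c⁻¹ * ψ)) (Ψ (X j)) = 0 := by
    rw [hj]; exact graphSubst_graphSlot hc0 hψ
  -- the restricted coordinate system `X_j ↦ X_a`, `X_i ↦ (X_a ↦ −ψ/c)(Ψ X_i)` (`i ≠ j`)
  let Φ₁ : MvPolynomial (Fin N) k →ₐ[k] MvPolynomial (Fin N) k :=
    aeval fun i => if i = j then X a else graphSubst a (-(C c⁻¹ * ψ)) (Ψ (X i))
  have hΦ₁X : ∀ i, Φ₁ (X i) = if i = j then X a else graphSubst a (-(C c⁻¹ * ψ)) (Ψ (X i)) :=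
    fun i => by simp only [Φ₁, aeval_X]
  have hcomp : Φ₁.comp (killHom {j}) =
      (graphSubst a (-(C c⁻¹ * ψ))).comp (Ψ : MvPolynomial (Fin N) k →ₐ[k] MvPolynomial (Fin N) k) := by
    refine MvPolynomial.algHom_ext fun x => ?_
    rw [AlgHom.comp_apply, AlgHom.comp_apply, AlgEquiv.coe_toAlgHom]
    by_cases hx : x = j
    · rw [hx, killHom_X_of_mem (Finset.mem_singleton_self j), map_zero, hρj]
    · rw [killHom_X_of_not_mem (fun h => hx (Finset.mem_singleton.mp h)), hΦ₁X, if_neg hx]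
  have hcomp' : ∀ P, Φ₁ (killHom {j} P) = graphSubst a (-(C c⁻¹ * ψ)) (Ψ P) := fun P => by
    rw [← AlgHom.comp_apply, hcomp, AlgHom.comp_apply, AlgEquiv.coe_toAlgHom]
  -- `Φ₁` is bijective
  have hsurj : Function.Surjective Φ₁ := by
    have hX : ∀ i, ∃ Q, Φ₁ Q = X i := by
      intro i
      by_cases hi : i = a
      · exact ⟨X j, by rw [hΦ₁X, if_pos rfl, hi]⟩
      · exact ⟨killHom {j} (Ψ.symm (X i)), by
          rw [hcomp', AlgEquiv.apply_symm_apply, graphSubst_X_of_ne a _ hi]⟩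
    intro P
    induction P using MvPolynomial.induction_on with
    | C r => exact ⟨C r, by rw [algHom_C, algebraMap_eq]⟩
    | add P Q hP hQ =>
      obtain ⟨P', hP'⟩ := hP
      obtain ⟨Q', hQ'⟩ := hQ
      exact ⟨P' + Q', by rw [map_add, hP', hQ']⟩
    | mul_X P i hP =>
      obtain ⟨P', hP'⟩ := hP
      obtain ⟨Q, hQ⟩ := hX i
      exact ⟨P' * Q, by rw [map_mul, hP', hQ]⟩
  have hinj : Function.Injective Φ₁ := injective_of_surjective_ringHom₁₄ Φ₁.toRingHom hsurj
  let Ψ₁ : MvPolynomial (Fin N) k ≃ₐ[k] MvPolynomial (Fin N) k := AlgEquiv.ofBijective Φ₁ ⟨hinj, hsurj⟩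
  have hΨ₁ : ∀ P, Ψ₁ P = Φ₁ P := fun P => AlgEquiv.ofBijective_apply _ _ P
  -- in the new coordinates the restriction is `(Ψ⁻¹ F)|_{X_j = 0}`
  have hkey : Ψ₁.symm (graphSubst a (-(C c⁻¹ * ψ)) F) = killHom {j} (Ψ.symm F) := by
    rw [AlgEquiv.symm_apply_eq, hΨ₁, hcomp', AlgEquiv.apply_symm_apply]
  have hcentre : IsCentreFor (graphSubst a (-(C c⁻¹ * ψ)) F) Ψ₁ (Function.update w j 0) := by
    refine ⟨fun i => ?_, fun i => ?_, ?_⟩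
    · rw [hΨ₁, hΦ₁X]
      split_ifs with hi
      · exact constantCoeff_X k a
      · rw [constantCoeff_graphSubst a hφ0, hΨ0]
    · rcases eq_or_ne i j with rfl | hi
      · rw [Function.update_self]
      · rw [Function.update_of_ne hi]; exact hw0 i
    · rw [hkey]
      intro d hd
      have hdj : d j = 0 := by
        by_contra hne
        exact (mem_support_iff.mp hd) (coeff_killHom_of_ne_zero (Finset.mem_singleton_self j) hne _)
      have hdG : d ∈ (Ψ.symm F).support := by
        rw [mem_support_iff] at hd ⊢
        rwa [coeff_killHom_of_forall_eq_zero
          (fun x hx => by rw [Finset.mem_singleton.mp hx]; exact hdj)] at hd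
      have hval : monomialValuation (Function.update w j 0) d = monomialValuation w d := by
        unfold monomialValuation Finsupp.sum
        refine Finset.sum_congr rfl fun x hx => ?_
        beta_reduce
        rw [Function.update_of_ne]
        rintro rfl
        exact (Finsupp.mem_support_iff.mp hx) hdj
      rw [hval]
      exact hadm d hdG
  -- finally exchange `X_j` and `X_a`, so that the new centre lives off `X_a`
  refine ⟨(renameEquiv k (Equiv.swap a j)).trans Ψ₁, Function.update w j 0 ∘ Equiv.swap a j, ?_, ?_,
    hcentre.perm (Equiv.swap a j), exps_comp_perm _ _⟩
  · have h1 : Ψ₁.symm (X a) = X j := by rw [AlgEquiv.symm_apply_eq, hΨ₁, hΦ₁X, if_pos rfl]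
    rw [AlgEquiv.symm_trans_apply, h1, renameEquiv_symm, renameEquiv_apply, rename_X, Equiv.symm_swap,
      Equiv.swap_apply_right]
  · rw [Function.comp_apply, Equiv.swap_apply_left, Function.update_self]

end Restrict

/-! ## §3 Lemma R: the deleted invariant is a `q`-residual invariant -/

section CharP

variable (p n : ℕ) [hp : Fact p.Prime] [CharP k p]

/-- In characteristic `p`, `q = p^n`: `(X_a ↦ −γ)(X_a^q + h) = h − γ^q` for `h` free of `X_a` (plumbing).
[cite: AbramovichTemkinWlodarczyk2024, §5.1 (p. 1575)] -/
theorem graphSubst_neg_X_pow_add (a : Fin N) (γ : MvPolynomial (Fin N) k) {h : MvPolynomial (Fin N) k}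
    (hh : a ∉ h.vars) : graphSubst a (-γ) (X a ^ p ^ n + h) = h - γ ^ p ^ n := by
  haveI : ExpChar (MvPolynomial (Fin N) k) p := ExpChar.prime hp.out
  rw [graphSubst_X_pow_add a _ _ hh, neg_pow, neg_one_pow_expChar_pow _ p n]
  ring

/-- **Lemma R (the restriction step of the census's `q`-residual predictor, engine 1 FE35), typed:** in
characteristic `p`, `q = p^n`, `h` free of `X_a`: if a centre `(Ψ, w)` for `X_a^q + h` has a graph-type
variable `Ψ(X_j) = c·X_a + ψ` over `X_a` (`c ≠ 0`, `ψ` free of `X_a`), then `exps w` with the `j`-th exponent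
deleted is a `q`-residual invariant of `h`: it is the invariant of a centre off `X_a` for the restriction
`(X_a ↦ −ψ/c)(X_a^q + h) = h − (ψ/c)^q`. (derived here)
[cite: AbramovichTemkinWlodarczyk2024, §5.1 (p. 1575), Thm. 5.3.1 (2)–(3) (p. 1578)]
[cite: CossartJannsenSaito2020, Def. 1.26, Def. 8.2 (p. 118)] -/
theorem exps_update_mem_residualInvariants (a : Fin N) {h : MvPolynomial (Fin N) k} (hh : a ∉ h.vars)
    {Ψ : MvPolynomial (Fin N) k ≃ₐ[k] MvPolynomial (Fin N) k} {w : Fin N → ℚ}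
    (hc : IsCentreFor (X a ^ p ^ n + h) Ψ w) {j : Fin N} {c : k} {ψ : MvPolynomial (Fin N) k}
    (hc0 : c ≠ 0) (hψ : a ∉ ψ.vars) (hj : Ψ (X j) = C c * X a + ψ) :
    exps (Function.update w j 0) ∈ residualInvariants (p ^ n) a h := by
  classical
  obtain ⟨Ψ', w', hΨ'a, hw'a, hc', hexps⟩ := hc.graphRestrict hc0 hψ hj
  have hψ0 : constantCoeff ψ = 0 := by
    have h0 := hc.1 j
    rwa [hj, map_add, map_mul, constantCoeff_C, constantCoeff_X, mul_zero, zero_add] at h0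
  refine ⟨C c⁻¹ * ψ, Ψ', w', fun hmem => ?_, by rw [map_mul, constantCoeff_C, hψ0, mul_zero], hΨ'a, hw'a,
    ?_, hexps⟩
  · rcases Finset.mem_union.mp (vars_mul _ _ hmem) with h1 | h2
    · simp [vars_C] at h1
    · exact hψ h2
  · rwa [graphSubst_neg_X_pow_add p n a _ hh] at hc'

end CharP

/-! ## §4 Inserting one exponent: `exps` with a weight singled out, and two monotonicity lemmas -/

/-- `exps` with one weight singled out: for `w_j ≠ 0`, `exps w = sort (1/w_j :: exps (w with w_j := 0))`.
(derived here) [cite: AbramovichTemkinWlodarczyk2024, §5.1 (p. 1575) (the invariant lists `1/γ_i` increasingly)] -/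
theorem exps_eq_insertionSort_cons_update {w : Fin N → ℚ} {j : Fin N} (hj : w j ≠ 0) :
    exps w = ((w j)⁻¹ :: exps (Function.update w j 0)).insertionSort (· ≤ ·) := by
  classical
  let δ : Fin N → ℚ := fun x => if x = j then w j else 0
  have hsplit : w = δ + Function.update w j 0 := by
    funext x
    by_cases hx : x = j
    · subst hx; simp [δ]
    · simp [δ, hx]
  have hdisj : ∀ x, δ x = 0 ∨ Function.update w j 0 x = 0 := by
    intro x
    by_cases hx : x = j
    · subst hx; exact Or.inr (Function.update_self _ _ _)
    · exact Or.inl (by simp [δ, hx])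
  have hfilter : (Finset.univ.filter fun x => δ x ≠ 0) = {j} := by
    ext x
    simp only [Finset.mem_filter, Finset.mem_univ, true_and, Finset.mem_singleton, δ]
    constructor
    · intro h
      by_contra hx
      exact h (if_neg hx)
    · rintro rfl
      rwa [if_pos rfl]
  have hexpsδ : exps δ = [(w j)⁻¹] := by
    unfold exps
    rw [hfilter, Finset.toList_singleton]
    simp [δ]
  conv_lhs => rw [hsplit]
  rw [exps_add_eq hdisj, hexpsδ, List.singleton_append]

/-- Inserting the same entry on both sides preserves the truncated-lex order (no sortedness needed).
(derived here) [cite: AbramovichTemkinWlodarczyk2024, §5.1 (p. 1575) (invariants ordered lexicographically,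
truncations larger)] -/
theorem truncLex_orderedInsert_lt_orderedInsert {A B : List ℚ} (h : ATW.TruncLex.lt A B) (x : ℚ) :
    ATW.TruncLex.lt (A.orderedInsert (· ≤ ·) x) (B.orderedInsert (· ≤ ·) x) := by
  induction A generalizing B with
  | nil => simp at h
  | cons a A' ih =>
    cases B with
    | nil =>
      simp only [List.orderedInsert]
      split_ifs with hxa
      · rw [ATW.TruncLex.cons_lt_cons]
        exact Or.inr ⟨rfl, ATW.TruncLex.cons_lt_nil _ _⟩
      · rw [ATW.TruncLex.cons_lt_cons]
        exact Or.inl (not_le.mp hxa)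
    | cons b B' =>
      rw [ATW.TruncLex.cons_lt_cons] at h
      simp only [List.orderedInsert]
      rcases h with hab | ⟨rfl, h'⟩
      · split_ifs with hxa hxb
        · rw [ATW.TruncLex.cons_lt_cons, ATW.TruncLex.cons_lt_cons]
          exact Or.inr ⟨rfl, Or.inl hab⟩
        · exact absurd (hxa.trans hab.le) hxb
        · rw [ATW.TruncLex.cons_lt_cons]
          exact Or.inl (not_le.mp hxa)
        · rw [ATW.TruncLex.cons_lt_cons]
          exact Or.inl hab
      · split_ifs with hxa
        · rw [ATW.TruncLex.cons_lt_cons, ATW.TruncLex.cons_lt_cons]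
          exact Or.inr ⟨rfl, Or.inr ⟨rfl, h'⟩⟩
        · rw [ATW.TruncLex.cons_lt_cons]
          exact Or.inr ⟨rfl, ih h'⟩

/-- Sorting in a smaller new entry gives a truncated-lex smaller list: `x < y ⟹ sort (x :: l) < sort (y :: l)`.
(derived here) [cite: AbramovichTemkinWlodarczyk2024, §5.1 (p. 1575) (invariants ordered lexicographically,
truncations larger)] -/
theorem truncLex_insertionSort_cons_lt_of_lt {x y : ℚ} (hxy : x < y) (l : List ℚ) :
    ATW.TruncLex.lt ((x :: l).insertionSort (· ≤ ·)) ((y :: l).insertionSort (· ≤ ·)) := by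
  refine ATW.TruncLex.lt_of_countP _ _ (List.pairwise_insertionSort _ _) (List.pairwise_insertionSort _ _) x
    (fun θ hθ => ?_) ?_
  · rw [(List.perm_insertionSort _ _).countP_eq, (List.perm_insertionSort _ _).countP_eq,
      List.countP_cons, List.countP_cons]
    have h1 : ¬ x ≤ θ := not_le.2 hθ
    have h2 : ¬ y ≤ θ := not_le.2 (hθ.trans hxy)
    simp [h1, h2]
  · rw [(List.perm_insertionSort _ _).countP_eq, (List.perm_insertionSort _ _).countP_eq,
      List.countP_cons, List.countP_cons]
    have h2 : ¬ y ≤ x := not_le.2 hxy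
    simp [h2]

/-! ## §5 Lemma S: a split maximum restricts to the maximal residual invariant -/

section CharP

variable (p n : ℕ) [hp : Fact p.Prime] [CharP k p]

/-- **Lemma S (split ⟹ the residual law with equality, engine 1 FE35), typed:** in characteristic `p`,
`q = p^n`, `h` free of `X_a`.  Suppose `max W(X_a^q + h)` is ATTAINED by a centre `(Ψ, w)` with a graph-type
variable `Ψ(X_j) = c·X_a + ψ` over `X_a` (`c ≠ 0`, `ψ` free of `X_a`) of exponent `1/w_j ≤ q`.  Then
`1/w_j = q`, the deleted invariant `exps (w with w_j := 0)` is THE MAXIMUM of `residualInvariants q a h`, and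
`max W(X_a^q + h) = sort (q, max residualInvariants q a h)`: Lemma L puts `sort (q, b)` in `W` for every
residual invariant `b` (and Lemma R makes the deleted invariant one), and a smaller first exponent or a larger
residual invariant would sort into a larger element of `W` (`§4`).  The census's normal form (a maximal
centre always has such a variable, FE35 N/P) is NOT typed. (derived here)
[cite: AbramovichTemkinWlodarczyk2024, §5.1 (p. 1575) (`inv = (a₁, …)` with the tail read on the maximal
contact), Thm. 5.3.1 (2)–(3) (p. 1578), Lemma 5.2.6 (p. 1576)] [cite: CossartJannsenSaito2020, Def. 1.26] -/
theorem isMaxInv_residualInvariants_of_graph (a : Fin N) {h : MvPolynomial (Fin N) k} (hh : a ∉ h.vars)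
    {Ψ : MvPolynomial (Fin N) k ≃ₐ[k] MvPolynomial (Fin N) k} {w : Fin N → ℚ}
    (hc : IsCentreFor (X a ^ p ^ n + h) Ψ w) (hmax : IsMaxInv (admissibleInvariants (X a ^ p ^ n + h)) (exps w))
    {j : Fin N} {c : k} {ψ : MvPolynomial (Fin N) k} (hc0 : c ≠ 0) (hψ : a ∉ ψ.vars)
    (hj : Ψ (X j) = C c * X a + ψ) (hwj : w j ≠ 0) (hle : (w j)⁻¹ ≤ (p ^ n : ℕ)) :
    (w j)⁻¹ = (p ^ n : ℕ) ∧ IsMaxInv (residualInvariants (p ^ n) a h) (exps (Function.update w j 0)) ∧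
      exps w = (((p ^ n : ℕ) : ℚ) :: exps (Function.update w j 0)).insertionSort (· ≤ ·) := by
  classical
  have hR := exps_update_mem_residualInvariants p n a hh hc hc0 hψ hj
  have hsplit := exps_eq_insertionSort_cons_update hwj
  have heq : (w j)⁻¹ = (p ^ n : ℕ) := by
    rcases hle.lt_or_eq with hlt | heq
    · exfalso
      refine hmax.2 _ (insertionSort_cons_mem_admissibleInvariants_X_pow_add p n a hh hR) ?_
      rw [hsplit]
      exact truncLex_insertionSort_cons_lt_of_lt hlt _
    · exact heq
  have hexps : exps w = (((p ^ n : ℕ) : ℚ) :: exps (Function.update w j 0)).insertionSort (· ≤ ·) := by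
    rw [hsplit, heq]
  refine ⟨heq, ⟨hR, fun b hb hlt => ?_⟩, hexps⟩
  have hL := insertionSort_cons_mem_admissibleInvariants_X_pow_add p n a hh hb
  have hbsorted : b.Pairwise (· ≤ ·) := by
    obtain ⟨-, -, w'', -, -, -, -, -, rfl⟩ := hb
    exact exps_sorted _
  refine hmax.2 _ hL ?_
  rw [hexps, List.insertionSort_cons, List.insertionSort_cons,
    (exps_sorted (Function.update w j 0)).insertionSort_eq, hbsorted.insertionSort_eq]
  exact truncLex_orderedInsert_lt_orderedInsert hlt _

/-- **The residual law for split maxima, value form:** under the hypotheses of Lemma S, for every `v`,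
`max residualInvariants q a h = v` iff `v` is the deleted invariant; hence `max W(X_a^q + h) = sort (q, v)`
for THE maximal residual invariant `v`. (derived here) [cite: AbramovichTemkinWlodarczyk2024, Thm. 5.3.1 (2)
(p. 1578)] -/
theorem exps_eq_insertionSort_cons_of_isMaxInv_residualInvariants (a : Fin N) {h : MvPolynomial (Fin N) k}
    (hh : a ∉ h.vars) {Ψ : MvPolynomial (Fin N) k ≃ₐ[k] MvPolynomial (Fin N) k} {w : Fin N → ℚ}
    (hc : IsCentreFor (X a ^ p ^ n + h) Ψ w) (hmax : IsMaxInv (admissibleInvariants (X a ^ p ^ n + h)) (exps w))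
    {j : Fin N} {c : k} {ψ : MvPolynomial (Fin N) k} (hc0 : c ≠ 0) (hψ : a ∉ ψ.vars)
    (hj : Ψ (X j) = C c * X a + ψ) (hwj : w j ≠ 0) (hle : (w j)⁻¹ ≤ (p ^ n : ℕ)) {v : List ℚ}
    (hv : IsMaxInv (residualInvariants (p ^ n) a h) v) :
    exps w = (((p ^ n : ℕ) : ℚ) :: v).insertionSort (· ≤ ·) := by
  obtain ⟨-, hmaxR, hexps⟩ := isMaxInv_residualInvariants_of_graph p n a hh hc hmax hc0 hψ hj hwj hle
  rw [hexps, hmaxR.unique hv]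

end CharP

/-! ## §6 Worked instance (characteristic 2): the split maximum of `x² + (y² + y³z)` certifies `max C_2 = (4, 4)` -/

section Instance

/-- `x` does not occur in `y² + y³z` (plumbing). [folklore] -/
private theorem zero_notMem_vars_y2_y3z₁₄ :
    (0 : Fin 3) ∉ (X 1 ^ 2 + X 1 ^ 3 * X 2 : MvPolynomial (Fin 3) k).vars := by
  classical
  intro hmem
  rcases Finset.mem_union.mp (vars_add_subset _ _ hmem) with h1 | h2
  · have h1' := vars_pow _ _ h1
    simp [vars_X] at h1'
  · rcases Finset.mem_union.mp (vars_mul _ _ h2) with h3 | h4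
    · have h3' := vars_pow _ _ h3
      simp [vars_X] at h3'
    · simp [vars_X] at h4

variable [CharP k 2]

/-- The centre `(x + y, y, z; 1/2, 1/4, 1/4)` for `x² + (y² + y³z)` in characteristic `2` — in the coordinates
`X_0 ↦ X_0 + X_1` the polynomial is the umbrella `X_0² + X_1³X_2`; its first variable `x + y` is of graph type
over `x`. (derived here) [cite: AbramovichTemkinWlodarczyk2024, §5.1 (p. 1575), Lemma 5.2.6 (p. 1576)] -/
theorem isCentreFor_addPolyShear_y2_y3z :
    IsCentreFor (X 0 ^ 2 ^ 1 + (X 1 ^ 2 + X 1 ^ 3 * X 2) : MvPolynomial (Fin 3) k) (addPolyShear 0 (X 1))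
      (singleWeights 0 2 + (singleWeights (1 : Fin 3) (3 + 1) + singleWeights (2 : Fin 3) (3 + 1))) := by
  classical
  haveI : ExpChar (MvPolynomial (Fin 3) k) 2 := ExpChar.prime Nat.prime_two
  have h1 : (1 : Fin 3) ≠ 0 := by decide
  have h2 : (2 : Fin 3) ≠ 0 := by decide
  have h12 : (1 : Fin 3) ≠ 2 := by decide
  have hX1 : (0 : Fin 3) ∉ (X 1 : MvPolynomial (Fin 3) k).vars := by simp [vars_X]
  have himage : addPolyShear 0 (X 1) (X 0 ^ 2 ^ 1 + X 1 ^ 3 * X 2 : MvPolynomial (Fin 3) k) =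
      X 0 ^ 2 ^ 1 + (X 1 ^ 2 + X 1 ^ 3 * X 2) := by
    rw [map_add, map_pow, map_mul, map_pow, addPolyShear_X_self_of_notMem 0 hX1,
      addPolyShear_X_of_ne 0 _ h1, addPolyShear_X_of_ne 0 _ h2, add_pow_expChar_pow]
    ring
  refine ⟨constantCoeff_addPolyShear_X 0 (constantCoeff_X k 1), fun x => ?_, ?_⟩
  · simp only [Pi.add_apply, singleWeights]
    split_ifs <;> norm_num
  · rw [← himage, AlgEquiv.symm_apply_apply, pow_one]
    have hx : IsAdmissibleFor (singleWeights (0 : Fin 3) 2) (X 0 ^ 2 : MvPolynomial (Fin 3) k) := by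
      simpa using (isCentreFor_X_pow (k := k) (N := 3) 0 two_pos).2.2
    refine IsAdmissibleFor.add_of_add (fun i => ?_) (fun i => ?_) hx (isAdmissibleFor_handle h12 3)
    · simp only [singleWeights]; split_ifs <;> norm_num
    · simp only [Pi.add_apply, singleWeights]; split_ifs <;> norm_num

/-- **`max C_2(y² + y³z) = (4, 4)` relative to `x`, certified** (characteristic `2`): the maximum `(2, 4, 4)`
of `W(x² + (y² + y³z))` splits off the graph-type variable `x + y` of exponent `2 = q`, so by Lemma S the
deleted invariant `(4, 4)` is the maximal `2`-residual invariant of `y² + y³z` — although `ord (y² + y³z) = 2`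
and `W(y² + y³z)` itself has maximum `(2)`. (derived here)
[cite: AbramovichTemkinWlodarczyk2024, Thm. 5.3.1 (2)–(3) (p. 1578), §5.1 (p. 1575)] -/
theorem isMaxInv_residualInvariants_y2_y3z :
    IsMaxInv (residualInvariants 2 (0 : Fin 3) (X 1 ^ 2 + X 1 ^ 3 * X 2 : MvPolynomial (Fin 3) k)) [4, 4] := by
  classical
  have h01 : (0 : Fin 3) ≠ 1 := by decide
  have h02 : (0 : Fin 3) ≠ 2 := by decide
  have h12 : (1 : Fin 3) ≠ 2 := by decide
  have hc := isCentreFor_addPolyShear_y2_y3z (k := k)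
  -- the weights: `w 0 = 1/2`, the invariant `(2, 4, 4)` and the deleted invariant `(4, 4)`
  have hw0 : (singleWeights (0 : Fin 3) 2 + (singleWeights (1 : Fin 3) (3 + 1) + singleWeights (2 : Fin 3) (3 + 1)))
      0 = 2⁻¹ := by
    simp [singleWeights, h01, h02]
  have hdisj : ∀ x : Fin 3, singleWeights (0 : Fin 3) 2 x = 0 ∨
      (singleWeights (1 : Fin 3) (3 + 1) + singleWeights (2 : Fin 3) (3 + 1)) x = 0 := by
    intro x
    by_cases hx : x = 0
    · subst hx; right; simp [singleWeights, h01, h02]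
    · left; simp [singleWeights, hx]
  have hew : exps (singleWeights (0 : Fin 3) 2 + (singleWeights (1 : Fin 3) (3 + 1) + singleWeights (2 : Fin 3) (3 + 1))) =
      [2, 4, 4] := by
    rw [exps_add_eq hdisj, exps_singleWeights 0 two_pos, exps_handleWeights h12]
    norm_num [List.insertionSort, List.orderedInsert]
  have hupd : Function.update (singleWeights (0 : Fin 3) 2 +
      (singleWeights (1 : Fin 3) (3 + 1) + singleWeights (2 : Fin 3) (3 + 1))) 0 0 =
      singleWeights (1 : Fin 3) (3 + 1) + singleWeights (2 : Fin 3) (3 + 1) := by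
    funext x
    by_cases hx : x = 0
    · subst hx; simp [singleWeights, h01, h02]
    · rw [Function.update_of_ne hx]; simp [singleWeights, hx]
  have he0 : exps (Function.update (singleWeights (0 : Fin 3) 2 +
      (singleWeights (1 : Fin 3) (3 + 1) + singleWeights (2 : Fin 3) (3 + 1))) 0 0) = [4, 4] := by
    rw [hupd, exps_handleWeights h12]; norm_num
  -- the maximum `(2, 4, 4)` of `W(x² + (y² + y³z))`: transport through `γ = y` to the umbrella `x² + y³z`
  have hmax : IsMaxInv (admissibleInvariants (X 0 ^ 2 ^ 1 + (X 1 ^ 2 + X 1 ^ 3 * X 2) : MvPolynomial (Fin 3) k))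
      (exps (singleWeights (0 : Fin 3) 2 +
        (singleWeights (1 : Fin 3) (3 + 1) + singleWeights (2 : Fin 3) (3 + 1)))) := by
    rw [hew]
    have hu := isMaxInv_X_pow_add_X_pow_mul_X (k := k) (N := 3) (i := 0) (j := 1) (l := 2) (p := 2) (m := 3)
      (by decide) (by decide) (by decide) le_rfl (by norm_num)
    norm_num at hu
    refine isMaxInv_X_pow_add_of_sub_pow (k := k) 2 1 (0 : Fin 3) (h := X 1 ^ 2 + X 1 ^ 3 * X 2) (γ := X 1)
      zero_notMem_vars_y2_y3z₁₄ (by simp [vars_X]) (constantCoeff_X k 1) ?_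
    have hsub : (X 1 ^ 2 + X 1 ^ 3 * X 2 : MvPolynomial (Fin 3) k) - X 1 ^ 2 ^ 1 = X 1 ^ 3 * X 2 := by ring
    rw [hsub, pow_one]
    exact hu
  have hj : addPolyShear 0 (X 1) (X 0 : MvPolynomial (Fin 3) k) = C 1 * X 0 + X 1 := by
    rw [C_1, one_mul]; exact addPolyShear_X_self_of_notMem 0 (by simp [vars_X])
  have hS := isMaxInv_residualInvariants_of_graph (k := k) 2 1 (0 : Fin 3) zero_notMem_vars_y2_y3z₁₄ hc hmax
    one_ne_zero (by simp [vars_X]) hj (by rw [hw0]; norm_num) (by rw [hw0]; norm_num)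
  rw [pow_one, he0] at hS
  exact hS.2.1

end Instance

end Literature.AlgebraicGeometry.Resolution.WeightedBlowup

end
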